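import Summits.MatrixMultiplication.MatrixMultiplication.Theorems.ObstructionDescentSchurWeylBorder
import Summits.MatrixMultiplication.MatrixMultiplication.Theorems.ObstructionDescentSaturationSplitTwo
import Literature.Computability.AlgebraicComplexity.TensorRestrictionRank
import Literature.Computability.AlgebraicComplexity.BorderRankRestriction

set_option linter.dupNamespace false
set_option autoImplicit false

/-!
# Obstruction descent — UNIVERSAL OCCURRENCE: a matrix-multiplication-free statement above the crux `P_O`
# (decomp-mm · lens 3 · gen 32, def-free)

`route-MatrixMultiplication-ObstructionDescent`, crux `NoOccurrenceObstruction` (`P_O`, stmt 29040); NODE-g32.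
Generation 29 certified `P_O ⟺ ∀ τ > 2, ∃ n₀, ∀ n ≥ n₀, S(⟨n,n,n⟩) ⊆ S(⟨m₀(n,τ)⟩)`, `m₀ = max(n², ⌈n^τ⌉)`
(`noOccurrenceObstruction_iff_minFormat_semigroup`; `S(t)` = Bürgisser–Ikenmeyer's semigroup of partition triples occurring in
the tensor powers of `t`).  Generation 30 split a containment `S(s) ⊆ S(t)` into SAT ∧ TOR; the critic (g12, s1) observed that
TOR quantifies over `S(⟨n,n,n⟩)`-membership and is the cell in costume wherever SAT is known, and asked for an INTRINSIC statement.

This file types the intrinsic statement.  **Universal occurrence at `(m, N)`**,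

  `UOCC(m,N) :  S(s) ⊆ S(⟨m⟩)  for EVERY tensor s of (cubic) format ≤ N`

— spelled literally below as `∀ {ι} [Fintype ι], |ι| ≤ N → ∀ s : ι → ι → ι → ℂ, ∀ λ ⊢ d, λ occurs in s^{⊗d} → λ occurs in
⟨m⟩^{⊗d}` — does not mention matrix multiplication: it says that the unit-tensor semigroup `S(⟨m⟩)` contains the whole
format-`N` occurrence semigroup `⋃_{s} S(s)` (= Bürgisser–Ikenmeyer's Kronecker semigroup `K(N)`: a triple occurs for SOME
format-`N` tensor iff it has at most `N` rows per factor and positive Kronecker coefficient; the tree has the direction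
`kroneckerCoeff_pos_of_isotypicSum₁₂₃_kroneckerPow_ne_zero`), equivalently that NO occurrence obstruction proves
`bR(s) > m` for ANY tensor `s` of format `N`.  Writing `u(N)` for the least `m` from which on `UOCC(·,N)` holds
(`uocc_mono_format`: it is upward closed in `m`), the content of the file is:

§1  `UOCC(m,N) ∧ n² ≤ N ⟹ S(⟨n,n,n⟩) ⊆ S(⟨m⟩)` (`semigroup_le_matMul_of_uocc`), hence
    **`P_O ⟸ UOCC-family`** `∀ τ > 2, ∃ n₀, ∀ n ≥ n₀, UOCC(m₀(n,τ), n²)` (`noOccurrenceObstruction_of_uocc_family`) and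
    **`P_O ⟸ u(N) ≤ N^{1+o(1)}`** (`noOccurrenceObstruction_of_uocc_threshold`: `∀ δ > 0`, eventually in `N`, `UOCC(m,N)` for all
    `m ≥ N^{1+δ}`).  Monotonicity in `m` and `N`; normal form over the single format `Fin N` (`uocc_iff_fin`, zero-padding).
§2  **Fill gives universal occurrence** (the theorem rungs): `⟨m⟩ ≥ s` for all `s` ⟹ `UOCC` (`uocc_of_fill`); rank fill
    `N² ≤ m ⟹ UOCC(m,N)` (`uocc_of_sq_le`, slicing `R(s) ≤ N²`), so **the UOCC-family is a THEOREM for `τ ≥ 4`**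
    (`uocc_family_of_four_le`) and `u(N) ≤ N²`; BORDER-rank fill `(∀ s, bR(s) ≤ m) ⟹ UOCC(m,N)` (`uocc_of_forall_algBorderRank_le`,
    Alder: `I(GL³⟨m⟩) ⊆ I(GL³·pad s)`), so Lickteig's typical rank `7` of `4×4×4` gives `UOCC(m,4)` for `m ≥ 7`, `u(4) ≤ 7`
    (`uocc_four_of_seven_le`; Lickteig's theorem — the named fact `Lickteig1985_typicalRank444`, PROVED in the tree as
    `Lickteig1985_typicalRank444_holds` — enters LITERALLY at `K = ℂ` as the hypothesis `∀ t : Fin 4 → Fin 4 → Fin 4 → ℂ,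
    algBorderRank t ≤ 7`, because its module awaited a farm build when this file was checked; discharge = one line).
§3  **Negative rungs** (matrix multiplication as the witness tensor): `¬UOCC(m, n²)` for `n ≥ 2`, `m ≤ n² + 1`
    (`not_uocc_of_le_sq_add_one`, BI 2011 Lemma 6.1), so `u(n²) ≥ n² + 2`; at `N = 4`: `¬UOCC(4,4)`, `¬UOCC(5,4)`, `UOCC(m,4)` for
    `m ≥ 16` unconditionally and for `m ≥ 7` by Lickteig — **`u(4) ∈ {6,7}`**, and `u(4) = 6 ⟺ UOCC(6,4)` is OPEN and STRICTLY
    STRONGER than the open `P_O`-cell `(2,6)` (`semigroup_le_two_six_of_uocc`).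
The UOCC-family is SUFFICIENT for `P_O`, not necessary (it is not known to follow from `ω = 2`: it speaks about every tensor of
the format, not about `⟨n,n,n⟩`); between `N^{1+δ}` and the generic border rank `≈ N²/3` of the format it asserts that occurrence
obstructions are blind for ALL tensors — consistent with what is in print as far as searched (NODE-g32 §5: the occurrence
obstructions exhibited in print, BI 2011 Lemma 6.1 at `m ≤ N + 1` and BI 2013 Thm. 1 at `m ≤ 3N/2 − 2` for `⟨n,n,n⟩`, `N = n²`, lie
below `3N/2`; no super-linear-in-`N` occurrence obstruction for border rank is recorded).
No proposition is defined; no `def`; sorry-free; standard axioms.  Nothing here proves `ω = 2` or closes an item.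
[cite: BurgisserIkenmeyer2011, Def. 3.1, §3.2 (K(m)), Lemma 6.1, §7] [cite: BurgisserIkenmeyer2013, Thm. 1]
[cite: Lickteig1985, p. 95] [cite: BurgisserClausenShokrollahi1997, (14.19), Thm. (20.3)] [cite: Blaser2013, §4]
-/

noncomputable section

open scoped BigOperators

namespace Summit.MatrixMultiplication.MatrixMultiplication.Theorems.ObstructionCalculus

open Literature.Computability.AlgebraicComplexity (actTensor kroneckerPow isotypicSum₁ isotypicSum₂ isotypicSum₃
  matMulTensor unitTensor tensorRank algBorderRank TensorRestrictsTo tensorRestrictsTo_actTensor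
  isotypicSum₁₂₃_kroneckerPow_ne_zero_of_restrictsTo tensorRestrictsTo_unitTensor_of_tensorRank_le
  tensorRank_le_card_mul_card₁₂)
open Summit.MatrixMultiplication.MatrixMultiplication.Theses.ObstructionDescent (NoOccurrenceObstruction)

/-! ## §1  Universal occurrence implies the cell, hence `P_O` -/

/-- **`UOCC(m,N)` gives the `P_O`-cell `(n,m)` for every `n² ≤ N`**: `S(⟨n,n,n⟩) ⊆ S(⟨m⟩)` (instantiate the universal statement
at the format `Fin n × Fin n` of `⟨n,n,n⟩`). [cite: BurgisserIkenmeyer2011, Def. 3.1, §5] -/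
theorem semigroup_le_matMul_of_uocc {m N n : ℕ} (hn : n * n ≤ N)
    (hU : ∀ {ι : Type} [Fintype ι], Fintype.card ι ≤ N → ∀ (s : ι → ι → ι → ℂ) (d : ℕ)
      (lam : Fin 3 → Nat.Partition d),
      isotypicSum₁ (lam 0) (isotypicSum₂ (lam 1) (isotypicSum₃ (lam 2) (kroneckerPow s d))) ≠ 0 →
      isotypicSum₁ (lam 0) (isotypicSum₂ (lam 1) (isotypicSum₃ (lam 2) (kroneckerPow (unitTensor ℂ m) d))) ≠ 0)
    (d : ℕ) (lam : Fin 3 → Nat.Partition d)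
    (hocc : isotypicSum₁ (lam 0) (isotypicSum₂ (lam 1) (isotypicSum₃ (lam 2)
      (kroneckerPow (matMulTensor ℂ n n n) d))) ≠ 0) :
    isotypicSum₁ (lam 0) (isotypicSum₂ (lam 1) (isotypicSum₃ (lam 2) (kroneckerPow (unitTensor ℂ m) d))) ≠ 0 :=
  hU (ι := Fin n × Fin n) (by simpa using hn) (matMulTensor ℂ n n n) d lam hocc

/-- **`P_O ⟸ UOCC-family.**  If for every `τ > 2`, eventually in `n`, universal occurrence holds at `(m₀(n,τ), n²)`,
`m₀ = max(n², ⌈n^τ⌉)` — every triple occurring for ANY tensor of format `≤ n²` occurs for `⟨m₀⟩` — then `NoOccurrenceObstruction`.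
The hypothesis does not mention matrix multiplication. [cite: BurgisserIkenmeyer2011, Def. 3.1, §5] -/
theorem noOccurrenceObstruction_of_uocc_family
    (hU : ∀ τ : ℝ, 2 < τ → ∃ n₀ : ℕ, ∀ n : ℕ, n₀ ≤ n →
      ∀ {ι : Type} [Fintype ι], Fintype.card ι ≤ n * n → ∀ (s : ι → ι → ι → ℂ) (d : ℕ)
        (lam : Fin 3 → Nat.Partition d),
        isotypicSum₁ (lam 0) (isotypicSum₂ (lam 1) (isotypicSum₃ (lam 2) (kroneckerPow s d))) ≠ 0 →
        isotypicSum₁ (lam 0) (isotypicSum₂ (lam 1) (isotypicSum₃ (lam 2)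
          (kroneckerPow (unitTensor ℂ (max (n * n) ⌈(n : ℝ) ^ τ⌉₊)) d))) ≠ 0) :
    NoOccurrenceObstruction := by
  rw [noOccurrenceObstruction_iff_minFormat_semigroup]
  intro τ hτ
  obtain ⟨n₀, hn₀⟩ := hU τ hτ
  exact ⟨n₀, fun n hn d lam hocc => semigroup_le_matMul_of_uocc le_rfl (fun hι s => hn₀ n hn hι s) d lam hocc⟩

/-- **`UOCC` is upward closed in the format `m` of the unit tensor** (`S(⟨m⟩) ⊆ S(⟨m'⟩)` for `m ≤ m'`), so the least admissible
`m` is a threshold `u(N)`. [cite: BurgisserIkenmeyer2011, §3.1] -/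
theorem uocc_mono_format {m m' N : ℕ} (hmm' : m ≤ m')
    (hU : ∀ {ι : Type} [Fintype ι], Fintype.card ι ≤ N → ∀ (s : ι → ι → ι → ℂ) (d : ℕ)
      (lam : Fin 3 → Nat.Partition d),
      isotypicSum₁ (lam 0) (isotypicSum₂ (lam 1) (isotypicSum₃ (lam 2) (kroneckerPow s d))) ≠ 0 →
      isotypicSum₁ (lam 0) (isotypicSum₂ (lam 1) (isotypicSum₃ (lam 2) (kroneckerPow (unitTensor ℂ m) d))) ≠ 0)
    {ι : Type} [Fintype ι] (hι : Fintype.card ι ≤ N) (s : ι → ι → ι → ℂ) (d : ℕ) (lam : Fin 3 → Nat.Partition d)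
    (hocc : isotypicSum₁ (lam 0) (isotypicSum₂ (lam 1) (isotypicSum₃ (lam 2) (kroneckerPow s d))) ≠ 0) :
    isotypicSum₁ (lam 0) (isotypicSum₂ (lam 1) (isotypicSum₃ (lam 2) (kroneckerPow (unitTensor ℂ m') d))) ≠ 0 :=
  isotypicSum_kroneckerPow_unitTensor_mono hmm' lam (hU hι s d lam hocc)

/-- **`UOCC` is downward closed in the format bound `N`** (fewer tensors to test). [bookkeeping] -/
theorem uocc_anti_bound {m N N' : ℕ} (hNN' : N' ≤ N)
    (hU : ∀ {ι : Type} [Fintype ι], Fintype.card ι ≤ N → ∀ (s : ι → ι → ι → ℂ) (d : ℕ)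
      (lam : Fin 3 → Nat.Partition d),
      isotypicSum₁ (lam 0) (isotypicSum₂ (lam 1) (isotypicSum₃ (lam 2) (kroneckerPow s d))) ≠ 0 →
      isotypicSum₁ (lam 0) (isotypicSum₂ (lam 1) (isotypicSum₃ (lam 2) (kroneckerPow (unitTensor ℂ m) d))) ≠ 0)
    {ι : Type} [Fintype ι] (hι : Fintype.card ι ≤ N') (s : ι → ι → ι → ℂ) (d : ℕ) (lam : Fin 3 → Nat.Partition d)
    (hocc : isotypicSum₁ (lam 0) (isotypicSum₂ (lam 1) (isotypicSum₃ (lam 2) (kroneckerPow s d))) ≠ 0) :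
    isotypicSum₁ (lam 0) (isotypicSum₂ (lam 1) (isotypicSum₃ (lam 2) (kroneckerPow (unitTensor ℂ m) d))) ≠ 0 :=
  hU (hι.trans hNN') s d lam hocc

/-- **Normal form: it suffices to test tensors on the single index type `Fin N`** (a tensor on `|ι| ≤ N` letters is zero-padded
into `Fin N` without changing its semigroup, `isotypicSum_kroneckerPow_padTensor_ne_zero_iff`).  In this form `UOCC(m,N)` reads
`⋃_{s ∈ (ℂ^N)^{⊗3}} S(s) ⊆ S(⟨m⟩)`, i.e. `K(N) ⊆ S(⟨m⟩)` for Bürgisser–Ikenmeyer's Kronecker semigroup of format `N`.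
[cite: BurgisserIkenmeyer2011, §2, §3.2] -/
theorem uocc_iff_fin {m N : ℕ} :
    (∀ {ι : Type} [Fintype ι], Fintype.card ι ≤ N → ∀ (s : ι → ι → ι → ℂ) (d : ℕ)
      (lam : Fin 3 → Nat.Partition d),
      isotypicSum₁ (lam 0) (isotypicSum₂ (lam 1) (isotypicSum₃ (lam 2) (kroneckerPow s d))) ≠ 0 →
      isotypicSum₁ (lam 0) (isotypicSum₂ (lam 1) (isotypicSum₃ (lam 2) (kroneckerPow (unitTensor ℂ m) d))) ≠ 0) ↔
    (∀ (s : Fin N → Fin N → Fin N → ℂ) (d : ℕ) (lam : Fin 3 → Nat.Partition d),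
      isotypicSum₁ (lam 0) (isotypicSum₂ (lam 1) (isotypicSum₃ (lam 2) (kroneckerPow s d))) ≠ 0 →
      isotypicSum₁ (lam 0) (isotypicSum₂ (lam 1) (isotypicSum₃ (lam 2) (kroneckerPow (unitTensor ℂ m) d))) ≠ 0) := by
  classical
  refine ⟨fun h s d lam hocc => h (by simp) s d lam hocc, fun h ι _ hι s d lam hocc => ?_⟩
  have he : Function.Injective (fun i : ι => Fin.castLE hι (Fintype.equivFin ι i)) :=
    fun i j hij => (Fintype.equivFin ι).injective (Fin.castLE_injective hι hij)
  rw [← isotypicSum_kroneckerPow_padTensor_ne_zero_iff he] at hocc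
  exact h _ d lam hocc

/-- **`P_O ⟸ u(N) ≤ N^{1+o(1)}`** (threshold form, matrix-multiplication-free): if for every `δ > 0`, eventually in the format `N`,
universal occurrence `UOCC(m,N)` holds for EVERY `m ≥ N^{1+δ}`, then `NoOccurrenceObstruction` (take `δ = (τ−2)/2` and `N = n²`:
`m₀(n,τ) ≥ n^τ = N^{1+δ}`).  Known: `u(N) ≤ N²` (`uocc_of_sq_le`), `u(n²) ≥ n² + 2` (`not_uocc_of_le_sq_add_one`).
[cite: BurgisserIkenmeyer2011, Def. 3.1, §5, Lemma 6.1] -/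
theorem noOccurrenceObstruction_of_uocc_threshold
    (hU : ∀ δ : ℝ, 0 < δ → ∃ N₀ : ℕ, ∀ N m : ℕ, N₀ ≤ N → (N : ℝ) ^ (1 + δ) ≤ (m : ℝ) →
      ∀ {ι : Type} [Fintype ι], Fintype.card ι ≤ N → ∀ (s : ι → ι → ι → ℂ) (d : ℕ)
        (lam : Fin 3 → Nat.Partition d),
        isotypicSum₁ (lam 0) (isotypicSum₂ (lam 1) (isotypicSum₃ (lam 2) (kroneckerPow s d))) ≠ 0 →
        isotypicSum₁ (lam 0) (isotypicSum₂ (lam 1) (isotypicSum₃ (lam 2) (kroneckerPow (unitTensor ℂ m) d))) ≠ 0) :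
    NoOccurrenceObstruction := by
  refine noOccurrenceObstruction_of_uocc_family fun τ hτ => ?_
  have hδ : 0 < (τ - 2) / 2 := by linarith
  obtain ⟨N₀, hN₀⟩ := hU ((τ - 2) / 2) hδ
  refine ⟨N₀, fun n hn ι _ hι s d lam hocc => hN₀ (n * n) _ (hn.trans (Nat.le_mul_self n)) ?_ hι s d lam hocc⟩
  have hn0 : (0 : ℝ) ≤ (n : ℝ) := Nat.cast_nonneg n
  have h1 : ((n * n : ℕ) : ℝ) ^ (1 + (τ - 2) / 2) = (n : ℝ) ^ τ := by
    calc ((n * n : ℕ) : ℝ) ^ (1 + (τ - 2) / 2) = ((n : ℝ) ^ (2 : ℝ)) ^ (1 + (τ - 2) / 2) := by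
          rw [Nat.cast_mul, Real.rpow_two, sq]
      _ = (n : ℝ) ^ (2 * (1 + (τ - 2) / 2)) := by rw [Real.rpow_mul hn0]
      _ = (n : ℝ) ^ τ := by
          congr 1
          ring
  rw [h1]
  exact (Nat.le_ceil _).trans (by exact_mod_cast le_max_right (n * n) ⌈(n : ℝ) ^ τ⌉₊)

/-! ## §2  Fill gives universal occurrence (the theorem rungs) -/

/-- **Restriction fill gives `UOCC`**: if every tensor of format `≤ N` is a restriction of `⟨m⟩` then `UOCC(m,N)` (occurrence
is monotone under restriction, `isotypicSum₁₂₃_kroneckerPow_ne_zero_of_restrictsTo`).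
[cite: BurgisserIkenmeyer2011, §3.1] [cite: vandenBergChristandlLysikovNieuwboerWalterZuiddam2025, Prop. 2.7] -/
theorem uocc_of_fill {m N : ℕ}
    (hfill : ∀ {ι : Type} [Fintype ι], Fintype.card ι ≤ N → ∀ s : ι → ι → ι → ℂ, TensorRestrictsTo (unitTensor ℂ m) s) :
    ∀ {ι : Type} [Fintype ι], Fintype.card ι ≤ N → ∀ (s : ι → ι → ι → ℂ) (d : ℕ)
      (lam : Fin 3 → Nat.Partition d),
      isotypicSum₁ (lam 0) (isotypicSum₂ (lam 1) (isotypicSum₃ (lam 2) (kroneckerPow s d))) ≠ 0 →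
      isotypicSum₁ (lam 0) (isotypicSum₂ (lam 1) (isotypicSum₃ (lam 2) (kroneckerPow (unitTensor ℂ m) d))) ≠ 0 :=
  fun hι s _ _ hocc => isotypicSum₁₂₃_kroneckerPow_ne_zero_of_restrictsTo (hfill hι s) hocc

/-- **Rank fill gives `UOCC`**: if every tensor of format `≤ N` has rank `≤ m` then `UOCC(m,N)` (a tensor of rank `≤ m` is a
restriction of `⟨m⟩`, BCS (14.19)). [cite: BurgisserClausenShokrollahi1997, (14.19)] [cite: BurgisserIkenmeyer2011, §3.1] -/
theorem uocc_of_forall_tensorRank_le {m N : ℕ}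
    (hR : ∀ {ι : Type} [Fintype ι], Fintype.card ι ≤ N → ∀ s : ι → ι → ι → ℂ, tensorRank s ≤ m) :
    ∀ {ι : Type} [Fintype ι], Fintype.card ι ≤ N → ∀ (s : ι → ι → ι → ℂ) (d : ℕ)
      (lam : Fin 3 → Nat.Partition d),
      isotypicSum₁ (lam 0) (isotypicSum₂ (lam 1) (isotypicSum₃ (lam 2) (kroneckerPow s d))) ≠ 0 →
      isotypicSum₁ (lam 0) (isotypicSum₂ (lam 1) (isotypicSum₃ (lam 2) (kroneckerPow (unitTensor ℂ m) d))) ≠ 0 :=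
  uocc_of_fill fun hι s => tensorRestrictsTo_unitTensor_of_tensorRank_le s (hR hι s)

/-- **`N² ≤ m ⟹ UOCC(m,N)`, unconditionally**: a tensor on `|ι| ≤ N` letters has rank `≤ |ι|² ≤ N²` (slicing, Bläser §4), so it
is a restriction of `⟨m⟩`.  Hence the universal-occurrence threshold satisfies `u(N) ≤ N²`. [cite: Blaser2013, §4]
[cite: BurgisserClausenShokrollahi1997, (14.19)] -/
theorem uocc_of_sq_le {m N : ℕ} (h : N * N ≤ m) :
    ∀ {ι : Type} [Fintype ι], Fintype.card ι ≤ N → ∀ (s : ι → ι → ι → ℂ) (d : ℕ)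
      (lam : Fin 3 → Nat.Partition d),
      isotypicSum₁ (lam 0) (isotypicSum₂ (lam 1) (isotypicSum₃ (lam 2) (kroneckerPow s d))) ≠ 0 →
      isotypicSum₁ (lam 0) (isotypicSum₂ (lam 1) (isotypicSum₃ (lam 2) (kroneckerPow (unitTensor ℂ m) d))) ≠ 0 := by
  refine uocc_of_forall_tensorRank_le fun {ι} _ hι s => ?_
  classical
  exact (tensorRank_le_card_mul_card₁₂ s).trans ((Nat.mul_le_mul hι hι).trans h)

/-- **The UOCC-family is a THEOREM for `τ ≥ 4`**: `UOCC(m₀(n,τ), n²)` for every `n`, since `m₀(n,τ) ≥ n^τ ≥ n⁴ = (n²)²`.  (So the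
content of the UOCC-family, like that of `P_O`, is the range `2 < τ < 4`; there it is NOT implied by fill — the generic border
rank of format `N` is `≈ N²/3`.) [cite: Blaser2013, §4] [cite: Lickteig1985, p. 95] -/
theorem uocc_family_of_four_le {τ : ℝ} (hτ : 4 ≤ τ) (n : ℕ) :
    ∀ {ι : Type} [Fintype ι], Fintype.card ι ≤ n * n → ∀ (s : ι → ι → ι → ℂ) (d : ℕ)
      (lam : Fin 3 → Nat.Partition d),
      isotypicSum₁ (lam 0) (isotypicSum₂ (lam 1) (isotypicSum₃ (lam 2) (kroneckerPow s d))) ≠ 0 →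
      isotypicSum₁ (lam 0) (isotypicSum₂ (lam 1) (isotypicSum₃ (lam 2) (kroneckerPow (unitTensor ℂ (max (n * n) ⌈(n : ℝ) ^ τ⌉₊)) d))) ≠ 0 := by
  refine uocc_of_sq_le ?_
  rcases Nat.eq_zero_or_pos n with rfl | hn
  · simp
  have hn1 : (1 : ℝ) ≤ (n : ℝ) := by exact_mod_cast hn
  have h1 : ((n * n * (n * n) : ℕ) : ℝ) ≤ (n : ℝ) ^ τ := by
    calc ((n * n * (n * n) : ℕ) : ℝ) = (n : ℝ) ^ ((4 : ℕ) : ℝ) := by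
          rw [Real.rpow_natCast]
          push_cast
          ring
      _ ≤ (n : ℝ) ^ τ := Real.rpow_le_rpow_of_exponent_le hn1 (by exact_mod_cast hτ)
  have h2 : n * n * (n * n) ≤ ⌈(n : ℝ) ^ τ⌉₊ := by exact_mod_cast h1.trans (Nat.le_ceil _)
  exact h2.trans (le_max_right _ _)

/-- **A border-rank bound on one format transfers to all smaller index types** (zero-pad into `Fin N` and un-pad by the
transpose `0/1` matrices: the tensor is a restriction of its padding; border rank is monotone under restriction). [bookkeeping]
[cite: ConnerGesmundoLandsbergVentura2022, §1.1] -/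
theorem algBorderRank_le_of_forall_fin {N r : ℕ} (h : ∀ s : Fin N → Fin N → Fin N → ℂ, algBorderRank s ≤ r)
    {ι : Type} [Fintype ι] (hι : Fintype.card ι ≤ N) (s : ι → ι → ι → ℂ) : algBorderRank s ≤ r := by
  classical
  have he : Function.Injective (fun i : ι => Fin.castLE hι (Fintype.equivFin ι i)) :=
    fun i j hij => (Fintype.equivFin ι).injective (Fin.castLE_injective hι hij)
  calc algBorderRank s
      = algBorderRank (actTensor
          (fun (i : ι) (a : Fin N) => if Fin.castLE hι (Fintype.equivFin ι i) = a then (1 : ℂ) else 0)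
          (fun (i : ι) (a : Fin N) => if Fin.castLE hι (Fintype.equivFin ι i) = a then (1 : ℂ) else 0)
          (fun (i : ι) (a : Fin N) => if Fin.castLE hι (Fintype.equivFin ι i) = a then (1 : ℂ) else 0)
          (padTensor (fun i : ι => Fin.castLE hι (Fintype.equivFin ι i)) s)) := by
        rw [actTensor_padTensor_eq_self he]
    _ ≤ algBorderRank (padTensor (fun i : ι => Fin.castLE hι (Fintype.equivFin ι i)) s) :=
        (tensorRestrictsTo_actTensor _ _ _ _).algBorderRank_le
    _ ≤ r := h _

/-- **Border-rank fill gives `UOCC`** (Alder + the calculus): if every tensor of format `N ≤ m` has border rank `≤ m`, then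
`UOCC(m,N)`.  For `s` on `|ι| ≤ N` letters, `pad_m s` has border rank `≤ m`, so `I(GL_m³·⟨m⟩) ⊆ I(GL_m³·pad_m s)`
(`orbitVanishing_unitTensor_le_of_algBorderRank_le`), and calculus containment gives semigroup containment
(`isotypicSum_ne_zero_imp_of_hwvSpace_le_imp`); padding does not change the semigroup.
[cite: BurgisserClausenShokrollahi1997, Thm. (20.3)] [cite: BurgisserIkenmeyer2011, §3.1] -/
theorem uocc_of_forall_algBorderRank_le {m N : ℕ} (hNm : N ≤ m)
    (hbr : ∀ s : Fin N → Fin N → Fin N → ℂ, algBorderRank s ≤ m) :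
    ∀ {ι : Type} [Fintype ι], Fintype.card ι ≤ N → ∀ (s : ι → ι → ι → ℂ) (d : ℕ)
      (lam : Fin 3 → Nat.Partition d),
      isotypicSum₁ (lam 0) (isotypicSum₂ (lam 1) (isotypicSum₃ (lam 2) (kroneckerPow s d))) ≠ 0 →
      isotypicSum₁ (lam 0) (isotypicSum₂ (lam 1) (isotypicSum₃ (lam 2) (kroneckerPow (unitTensor ℂ m) d))) ≠ 0 := by
  intro ι _ hι s d lam hocc
  classical
  have he : Function.Injective (fun i : ι => Fin.castLE (hι.trans hNm) (Fintype.equivFin ι i)) :=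
    fun i j hij => (Fintype.equivFin ι).injective (Fin.castLE_injective (hι.trans hNm) hij)
  have hocc' := (isotypicSum_kroneckerPow_padTensor_ne_zero_iff he s lam).2 hocc
  have hbr' : algBorderRank (padTensor (fun i : ι => Fin.castLE (hι.trans hNm) (Fintype.equivFin ι i)) s) ≤ m := by
    rw [padTensor_eq_actTensor_ind]
    exact (tensorRestrictsTo_actTensor _ _ _ s).algBorderRank_le.trans (algBorderRank_le_of_forall_fin hbr hι s)
  have horb := orbitVanishing_unitTensor_le_of_algBorderRank_le hbr'
  exact isotypicSum_ne_zero_imp_of_hwvSpace_le_imp (unitTensor ℂ m) _ (fun d Λ hle => hle.trans horb) d lam hocc'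

/-- **Lickteig's typical rank of `4×4×4` gives `UOCC(m,4)` for every `m ≥ 7`** (every `4×4×4` tensor has border rank `≤ 7`), i.e.
`u(4) ≤ 7`: every triple occurring for any tensor of format `≤ 4` occurs for `⟨7⟩`.  The hypothesis is LITERALLY the named fact
`Literature.Computability.AlgebraicComplexity.Lickteig1985_typicalRank444` at `K = ℂ` — PROVED in the tree
(`Lickteig1985_typicalRank444_holds`, Terracini + Jacobian criterion + Alder; its module awaits a farm build at the time of
writing, whence the literal hypothesis; the discharge is the one-liner `fun t => Lickteig1985_typicalRank444_holds ℂ t`).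
[cite: Lickteig1985, p. 95] [cite: BurgisserClausenShokrollahi1997, Ex. 20.9, Thm. (20.3)] -/
theorem uocc_four_of_seven_le (hL : ∀ t : Fin 4 → Fin 4 → Fin 4 → ℂ, algBorderRank t ≤ 7) {m : ℕ} (hm : 7 ≤ m) :
    ∀ {ι : Type} [Fintype ι], Fintype.card ι ≤ 4 → ∀ (s : ι → ι → ι → ℂ) (d : ℕ)
      (lam : Fin 3 → Nat.Partition d),
      isotypicSum₁ (lam 0) (isotypicSum₂ (lam 1) (isotypicSum₃ (lam 2) (kroneckerPow s d))) ≠ 0 →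
      isotypicSum₁ (lam 0) (isotypicSum₂ (lam 1) (isotypicSum₃ (lam 2) (kroneckerPow (unitTensor ℂ m) d))) ≠ 0 :=
  uocc_mono_format hm (uocc_of_forall_algBorderRank_le (by norm_num) hL)

/-! ## §3  Negative rungs: matrix multiplication as the witness tensor -/

/-- **`¬UOCC(m, n²)` for `n ≥ 2` and `m ≤ n² + 1`**: the tensor `⟨n,n,n⟩` of format `n²` has a triple (Bürgisser–Ikenmeyer's
`λₙ ⊢ 2n²`, Lemma 6.1, tree theorem `burgisserIkenmeyer2011_lemma_6_1_holds`) occurring for it and not for `⟨n²+1⟩`.  Hence the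
universal-occurrence threshold satisfies `u(n²) ≥ n² + 2`: on the diagonal `N ≤ m ≤ N+1` occurrence obstructions exist.
[cite: BurgisserIkenmeyer2011, Lemma 6.1] -/
theorem not_uocc_of_le_sq_add_one (n : ℕ) (hn : 2 ≤ n) {m : ℕ} (hm : m ≤ n ^ 2 + 1) :
    ¬ (∀ {ι : Type} [Fintype ι], Fintype.card ι ≤ n * n → ∀ (s : ι → ι → ι → ℂ) (d : ℕ)
      (lam : Fin 3 → Nat.Partition d),
      isotypicSum₁ (lam 0) (isotypicSum₂ (lam 1) (isotypicSum₃ (lam 2) (kroneckerPow s d))) ≠ 0 →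
      isotypicSum₁ (lam 0) (isotypicSum₂ (lam 1) (isotypicSum₃ (lam 2) (kroneckerPow (unitTensor ℂ m) d))) ≠ 0) :=
  fun hU => not_semigroup_le_of_le_sq_add_one n hn hm fun d lam hocc => semigroup_le_matMul_of_uocc le_rfl hU d lam hocc

/-- **Row `N = 4`, lower end: `¬UOCC(m,4)` for `m ≤ 5`** (`n = 2` above: `λ₂ = ((5,1,1,1),(2⁴),(2⁴)) ⊢ 8` occurs for `⟨2,2,2⟩` and not
for `⟨5⟩`). [cite: BurgisserIkenmeyer2011, Lemma 6.1] -/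
theorem not_uocc_four_of_le_five {m : ℕ} (hm : m ≤ 5) :
    ¬ (∀ {ι : Type} [Fintype ι], Fintype.card ι ≤ 4 → ∀ (s : ι → ι → ι → ℂ) (d : ℕ)
      (lam : Fin 3 → Nat.Partition d),
      isotypicSum₁ (lam 0) (isotypicSum₂ (lam 1) (isotypicSum₃ (lam 2) (kroneckerPow s d))) ≠ 0 →
      isotypicSum₁ (lam 0) (isotypicSum₂ (lam 1) (isotypicSum₃ (lam 2) (kroneckerPow (unitTensor ℂ m) d))) ≠ 0) :=
  fun hU => not_uocc_of_le_sq_add_one 2 le_rfl (hm.trans (by norm_num)) fun hι s d lam hocc => hU (by omega) s d lam hocc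

/-- **Row `N = 4`, upper end, unconditionally: `UOCC(m,4)` for `m ≥ 16`** (rank fill). [cite: Blaser2013, §4] -/
theorem uocc_four_of_sixteen_le {m : ℕ} (hm : 16 ≤ m) :
    ∀ {ι : Type} [Fintype ι], Fintype.card ι ≤ 4 → ∀ (s : ι → ι → ι → ℂ) (d : ℕ)
      (lam : Fin 3 → Nat.Partition d),
      isotypicSum₁ (lam 0) (isotypicSum₂ (lam 1) (isotypicSum₃ (lam 2) (kroneckerPow s d))) ≠ 0 →
      isotypicSum₁ (lam 0) (isotypicSum₂ (lam 1) (isotypicSum₃ (lam 2) (kroneckerPow (unitTensor ℂ m) d))) ≠ 0 :=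
  uocc_mono_format hm (uocc_of_sq_le (m := 16) (N := 4) (by norm_num))

/-- **`UOCC(m,4)` forces `m ≥ 6`** (contrapositive of `not_uocc_four_of_le_five`).  With `uocc_four_of_seven_le`: given Lickteig,
**`u(4) ∈ {6, 7}`**, and `u(4) = 6 ⟺ UOCC(6,4)`, which is open. [cite: BurgisserIkenmeyer2011, Lemma 6.1] [cite: Lickteig1985, p. 95] -/
theorem six_le_of_uocc_four {m : ℕ}
    (hU : ∀ {ι : Type} [Fintype ι], Fintype.card ι ≤ 4 → ∀ (s : ι → ι → ι → ℂ) (d : ℕ)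
      (lam : Fin 3 → Nat.Partition d),
      isotypicSum₁ (lam 0) (isotypicSum₂ (lam 1) (isotypicSum₃ (lam 2) (kroneckerPow s d))) ≠ 0 →
      isotypicSum₁ (lam 0) (isotypicSum₂ (lam 1) (isotypicSum₃ (lam 2) (kroneckerPow (unitTensor ℂ m) d))) ≠ 0) : 6 ≤ m := by
  by_contra h
  exact not_uocc_four_of_le_five (by omega) hU

/-- **`UOCC(6,4)` is STRONGER than the open `P_O`-cell `(2,6)`**: it gives `S(⟨2,2,2⟩) ⊆ S(⟨6⟩)` (and, beyond it, the occurrence in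
`⟨6⟩` of every triple occurring for ANY `4×4×4` tensor — e.g. for tensors of border rank `7`, which exist by Lickteig).  The cell
`(2,6)` is the `n = 2` cell of `P_O` for `τ ∈ (log₂ 5, log₂ 6]`. [cite: BurgisserIkenmeyer2011, §5, Lemma 6.1] [cite: Lickteig1985, p. 95] -/
theorem semigroup_le_two_six_of_uocc
    (hU : ∀ {ι : Type} [Fintype ι], Fintype.card ι ≤ 4 → ∀ (s : ι → ι → ι → ℂ) (d : ℕ)
      (lam : Fin 3 → Nat.Partition d),
      isotypicSum₁ (lam 0) (isotypicSum₂ (lam 1) (isotypicSum₃ (lam 2) (kroneckerPow s d))) ≠ 0 →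
      isotypicSum₁ (lam 0) (isotypicSum₂ (lam 1) (isotypicSum₃ (lam 2) (kroneckerPow (unitTensor ℂ 6) d))) ≠ 0)
    (d : ℕ) (lam : Fin 3 → Nat.Partition d)
    (hocc : isotypicSum₁ (lam 0) (isotypicSum₂ (lam 1) (isotypicSum₃ (lam 2)
      (kroneckerPow (matMulTensor ℂ 2 2 2) d))) ≠ 0) :
    isotypicSum₁ (lam 0) (isotypicSum₂ (lam 1) (isotypicSum₃ (lam 2) (kroneckerPow (unitTensor ℂ 6) d))) ≠ 0 :=
  semigroup_le_matMul_of_uocc (N := 4) (n := 2) (by norm_num) hU d lam hocc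

/-- **General square formats: `n² + 2 ≤ u(n²) ≤ n⁴`** — the threshold sits strictly above the diagonal and at most at the square;
`P_O` follows if it is `≤ (n²)^{1+o(1)}` (`noOccurrenceObstruction_of_uocc_threshold`).  Upper half, unconditionally:
`UOCC(m, n²)` for `m ≥ n⁴`. [cite: Blaser2013, §4] [cite: BurgisserIkenmeyer2011, Lemma 6.1] -/
theorem uocc_sq_of_pow_four_le (n : ℕ) {m : ℕ} (hm : n ^ 4 ≤ m) :
    ∀ {ι : Type} [Fintype ι], Fintype.card ι ≤ n * n → ∀ (s : ι → ι → ι → ℂ) (d : ℕ)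
      (lam : Fin 3 → Nat.Partition d),
      isotypicSum₁ (lam 0) (isotypicSum₂ (lam 1) (isotypicSum₃ (lam 2) (kroneckerPow s d))) ≠ 0 →
      isotypicSum₁ (lam 0) (isotypicSum₂ (lam 1) (isotypicSum₃ (lam 2) (kroneckerPow (unitTensor ℂ m) d))) ≠ 0 :=
  uocc_of_sq_le (by simpa [pow_succ, pow_zero, one_mul, mul_assoc] using hm)

end Summit.MatrixMultiplication.MatrixMultiplication.Theorems.ObstructionCalculus

end
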